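import Summits.HodgeConjecture.HodgeConjecture.Theorems.MarkmanPartnerTransportK3Sq2TypeHodgeGraphClassesGeneral

/-!
# Route MarkmanPartnerTransport · the CYCLE-INDUCED sector of the target `K3Sq2TypeHodge` (crux #5
# `LowPicardRealMultiplication`, every Picard rank, partner-free): HC⁴(X) for a marked `K3^{[2]}`-type
# fourfold whose transcendental Hodge endomorphisms are spanned by endomorphisms INDUCED BY ALGEBRAIC
# CLASSES on `X × X`

The `X`-side analogue of the K3-square sector theorem `CycleInducedSector.hodgeConjectureFor_square_of_cycleInducedSector`
(Varesco's bookkeeping) and of the rung F4 `SquareOfGenerator`. Gen 6's partner-free method for item #3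
(`…IsometrySpannedThirdOfGraphClasses`: class endomorphism `F_c`, transcendental projector, polarised Fujiki,
symmetrisation `q(F_c y, w) = Σ ½cᵢ (q(gᵢ y, w) + q(gᵢ w, y)) + β(y_N, w_N)`) never uses that the spanning
maps `gᵢ` are ISOMETRIES — only that they are rational, preserve Hodge types, and carry an algebraic
"graph class" `c_g ∈ A²(X)` with cubic form `(c_g ∪ y) ∪ w = (t·q(y,w) + q(gy,w) + q(gw,y))·P`. With the
toolkit of `…K3Sq2TypeHodgeGraphClassesGeneral` (graph classes from kappa classes for arbitrary `g`; kappa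
classes of cycle-induced `g` algebraic):

* `mem_algebraicClasses_two_of_spannedByGraphClasses`, `hodgeConjectureFor_of_spannedByGraphClasses` — gen 6's
  closing theorem with `SpannedByIsometries + Graph` replaced by ONE hypothesis: every rational Hodge
  endomorphism of `H²(X)` killing `N¹(X)` with transcendental image agrees on `T(X)` with `Σ cᵢ gᵢ`, `cᵢ ∈ ℚ`,
  `gᵢ` rational, type-preserving, each with an algebraic graph class;
* `hodgeConjectureFor_of_spannedByCycleInduced` — **HC⁴(X) for every marked smooth projective `K3^{[2]}`-type `X`
  whose rational Hodge endomorphisms of `T(X)` (extended by `0`) are `ℚ`-combinations of endomorphisms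
  `[Zᵢ]_*` INDUCED BY ALGEBRAIC CLASSES `Zᵢ ∈ A⁴(X × X)`** (rational, type-preserving), modulo
  {`VerbitskyGuan_cohomology_K3HilbertSquareType`, `OGrady2008_dualBBFClass_algebraic`, `QInvAlgebraic`,
  `Voisin2003_cupProduct_algebraicClasses`}; `hodgeConjectureFor_of_spannedByCycleInduced_of_charlesMarkman` —
  the same modulo {Verbitsky–Guan, O'Grady, Charles–Markman 2013}. This is the CYCLE-INDUCED SECTOR of the
  target: it contains the isometry third (Markman 2024: isometries are cycle-induced) and reduces the
  real-multiplication residue of crux #5 (`ρ(X) ≤ 3`, `E = End_Hdg T(X)` totally real, no partner) to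
  «`E` is spanned by cycle-induced endomorphisms» — the statement a spread line on the `X`-side would feed
  (flat generator over the RM component of `K3^{[2]}`-type moduli, algebraic along a dominant family),
  exactly as `RMSpreadFamily` does on the K3 side.

CONDITIONAL on the named facts displayed; no definition, no sorry. Prover seat hodge-nonav-19652-p1 (gen 7),
`--supports stmt-HodgeConjecture-19653`. Nothing here proves the crux, the target, or HC.

References: E. Markman, Compos. Math. 160 (2024) Thm. 1.1; F. Charles–E. Markman, Compos. Math. 149 (2013)
Thm. 1.1; K. O'Grady, Comm. Contemp. Math. 10 (2008) §2; M. Varesco, Math. Z. 305 (2023) §2; Yu. Zarhin,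
J. reine angew. Math. 341 (1983) Thm. 1.5.1; C. Voisin, *Hodge Theory II*, Prop. 9.20, Thm. 10.17.
-/
noncomputable section

set_option linter.dupNamespace false

open Module CategoryTheory MonoidalCategory CartesianMonoidalCategory
open Literature.AlgebraicTopology.SingularHomology Literature.Geometry.Kaehler
open Literature.AlgebraicGeometry Literature.AlgebraicGeometry.Motives Literature.AlgebraicGeometry.HodgeTheory
open Literature.AlgebraicGeometry.Hyperkaehler Literature.AlgebraicGeometry.Surfaces
open Summit.HodgeConjecture.HodgeConjecture.Theorems.NikulinTwinTransport
open Summit.HodgeConjecture.HodgeConjecture.Theorems.MarkmanPartnerTransport.BBFPositivity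

namespace Summit.HodgeConjecture.HodgeConjecture.Theorems.MarkmanPartnerTransport.PartnerLattice

/-- `MarkedK3Sq[X, φ, P, z]`: VERBATIM the `let MarkedK3Sq := …` binder of the route declarations of
MarkmanPartnerTransport (clauses (m1)–(m6)). Local notation only. -/
local notation3 (prettyPrint := false) "MarkedK3Sq[" X ", " φ ", " P ", " z "]" =>
  (((IsIntegralClass P ∧ ∀ Q : complexBetti X (2 * 4), IsIntegralClass Q → ∃ n : ℤ, Q = n • P) ∧
    (∀ c : complexBetti X 2, IsIntegralClass c ↔ ∃ v : K3HilbertIndex → ℤ, φ c = fun i => (v i : ℂ)) ∧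
    (∀ a : complexBetti X 2, cupPowTwo a 4 = ((3 : ℂ) * (k3HilbertForm 2 (φ a) (φ a)) ^ 2) • P) ∧
    (IsOfHodgeType 4 X 2 2 0 (LinearEquiv.symm φ z) ∧
      ∀ τ : complexBetti X 2, IsOfHodgeType 4 X 2 2 0 τ → ∃ t : ℂ, τ = t • LinearEquiv.symm φ z) ∧
    (∀ c : complexBetti X 2, IsOfHodgeType 4 X 2 1 1 c ↔
      (k3HilbertForm 2 (φ c) z = 0 ∧ k3HilbertForm 2 (φ c) (star z) = 0)) ∧
    (k3HilbertForm 2 z z = 0 ∧ 0 < (k3HilbertForm 2 (star z) z).re)))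

/-- `Cup3[c, y, w] = (c ∪ y) ∪ w ∈ H⁸` for `c ∈ H⁴`, `y, w ∈ H²`. Local notation only. -/
local notation3 (prettyPrint := false) "Cup3[" c ", " y ", " w "]" =>
  cupProduct (rfl : 2 * 3 + 2 = 2 * 4) (cupProduct (rfl : 2 * 2 + 2 = 2 * 3) c y) w

/-- `Kap[φ, g] = Σ_{ij} (G⁻¹)_{ij} · φ⁻¹eᵢ ∪ g(φ⁻¹eⱼ) ∈ H⁴(X(ℂ); ℂ)`, the kappa class of an endomorphism `g`
of `H²(X(ℂ); ℂ)`. Local notation only. -/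
local notation3 (prettyPrint := false) "Kap[" φ ", " g "]" =>
  (∑ i : K3HilbertIndex, ∑ j : K3HilbertIndex,
    (((k3HilbertGram 2).map (Int.cast : ℤ → ℂ))⁻¹ i j) •
      cupProduct (rfl : 2 + 2 = 2 * 2) ((LinearEquiv.symm φ) (Pi.single i 1))
        (g ((LinearEquiv.symm φ) (Pi.single j 1))))

variable {X : SchemeOver ℂ} {φ : complexBetti X 2 ≃ₗ[ℂ] (K3HilbertIndex → ℂ)} {P : complexBetti X (2 * 4)}
  {z : K3HilbertIndex → ℂ}

/-- `SpannedByGraph[X, φ, P]`: every rational Hodge endomorphism `f` of `H²(X)` killing `N¹(X)` with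
transcendental image agrees on `T(X)` with a `ℚ`-combination `Σ cᵢ gᵢ` of RATIONAL, TYPE-PRESERVING
endomorphisms `gᵢ` each carrying an ALGEBRAIC graph class `c_{gᵢ} ∈ A²(X)` with cubic form
`(c ∪ y) ∪ w = (t·q(y,w) + q(gᵢy,w) + q(gᵢw,y))·P`. Local notation only. -/
local notation3 (prettyPrint := false) "SpannedByGraph[" X ", " φ ", " P "]" =>
  ∀ f : complexBetti X 2 →ₗ[ℂ] complexBetti X 2, (∀ y, IsRationalClass y → IsRationalClass (f y)) →
    (∀ (i j : ℕ) y, IsOfHodgeType 4 X 2 i j y → IsOfHodgeType 4 X 2 i j (f y)) →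
    (∀ d : complexBetti X 2, d ∈ algebraicClasses X 1 → f d = 0) →
    (∀ y : complexBetti X 2, ∀ d : complexBetti X 2, d ∈ algebraicClasses X 1 →
      k3HilbertForm 2 (φ (f y)) (φ d) = 0) →
    ∃ (k : ℕ) (c : Fin k → ℚ) (g : Fin k → (complexBetti X 2 →ₗ[ℂ] complexBetti X 2)),
      (∀ i, (∀ y, IsRationalClass y → IsRationalClass (g i y)) ∧
        (∀ (a b : ℕ) y, IsOfHodgeType 4 X 2 a b y → IsOfHodgeType 4 X 2 a b (g i y)) ∧
        ∃ cg ∈ algebraicClasses X 2, ∃ t : ℂ, ∀ y w : complexBetti X 2,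
          Cup3[cg, y, w] = (t * k3HilbertForm 2 (φ y) (φ w) + k3HilbertForm 2 (φ (g i y)) (φ w) +
            k3HilbertForm 2 (φ (g i w)) (φ y)) • P) ∧
      ∀ y : complexBetti X 2, (∀ d : complexBetti X 2, d ∈ algebraicClasses X 1 →
        k3HilbertForm 2 (φ y) (φ d) = 0) → f y = ∑ i : Fin k, ((c i : ℂ) • g i y)

/-- `SpannedByCycle[X, φ, hX]`: every rational Hodge endomorphism of `H²(X)` killing `N¹(X)` with transcendental
image agrees on `T(X)` with a `ℚ`-combination of rational, type-preserving endomorphisms each INDUCED BY AN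
ALGEBRAIC CLASS `Z ∈ A⁴(X × X)` as the correspondence `[Z]_* = pr_{1*}(pr₂^*(–) ∪ Z)` (complex orientations).
Local notation only. -/
local notation3 (prettyPrint := false) "SpannedByCycle[" X ", " φ ", " hX "]" =>
  ∀ f : complexBetti X 2 →ₗ[ℂ] complexBetti X 2, (∀ y, IsRationalClass y → IsRationalClass (f y)) →
    (∀ (i j : ℕ) y, IsOfHodgeType 4 X 2 i j y → IsOfHodgeType 4 X 2 i j (f y)) →
    (∀ d : complexBetti X 2, d ∈ algebraicClasses X 1 → f d = 0) →
    (∀ y : complexBetti X 2, ∀ d : complexBetti X 2, d ∈ algebraicClasses X 1 →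
      k3HilbertForm 2 (φ (f y)) (φ d) = 0) →
    ∃ (k : ℕ) (c : Fin k → ℚ) (g : Fin k → (complexBetti X 2 →ₗ[ℂ] complexBetti X 2)),
      (∀ i, (∀ y, IsRationalClass y → IsRationalClass (g i y)) ∧
        (∀ (a b : ℕ) y, IsOfHodgeType 4 X 2 a b y → IsOfHodgeType 4 X 2 a b (g i y)) ∧
        ∃ Z ∈ algebraicClasses (X ⊗ X) 4, ∀ y : complexBetti X 2,
          g i y = corrAction complexOrientationFamily hX hX (rfl : 2 + 2 * 4 = 2 + 2 * 4) Z y) ∧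
      ∀ y : complexBetti X 2, (∀ d : complexBetti X 2, d ∈ algebraicClasses X 1 →
        k3HilbertForm 2 (φ y) (φ d) = 0) → f y = ∑ i : Fin k, ((c i : ℂ) • g i y)

/-! ### The closing theorem for an arbitrary spanning family with graph classes -/

/-- **A rational `(2,2)`-class on a marked smooth projective `K3^{[2]}`-type fourfold is algebraic, granted
`SpannedByGraph`** — gen 6's `mem_algebraicClasses_two_of_spannedByIsometries_of_graphClasses` with the spanning
isometries replaced by arbitrary rational type-preserving endomorphisms carrying graph classes; the proof is the
same (class endomorphism `F_c`, transcendental projector `π_T`, `π_T F_c π_T = Σ cᵢ gᵢ` on `T`, symmetrisation by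
the self-adjointness of `F_c` — not of the `gᵢ` —, symmetric correction form on `N¹(X)` by
`exists_algebraicClass_of_symmetricForm`, Verbitsky–Guan uniqueness `eq_of_cup3_eq`); the `gᵢ` preserve `N¹(X)` by
Lefschetz `(1,1)`. Modulo {Verbitsky–Guan, O'Grady, Voisin}. [cite: Zarhin1983HodgeGroupsK3, Thm. 1.5.1]
[cite: Novario2026HodgeClassesHilbertSquares, Thm. 6.2] [cite: OGrady2008NumericalK3Square, §3] -/
theorem mem_algebraicClasses_two_of_spannedByGraphClasses
    (hV : VerbitskyGuan_cohomology_K3HilbertSquareType) (hO : OGrady2008_dualBBFClass_algebraic)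
    (hcup : Voisin2003_cupProduct_algebraicClasses)
    (hX : IsSmoothProjective 4 X) (hK : IsOfK3HilbertSquareType X) (hM : MarkedK3Sq[X, φ, P, z])
    (hSG : SpannedByGraph[X, φ, P]) {c : complexBetti X (2 * 2)}
    (hcrat : IsRationalClass c) (hc22 : IsOfHodgeType 4 X (2 * 2) 2 2 c) : c ∈ algebraicClasses X 2 := by
  classical
  obtain ⟨F, hF⟩ := exists_classEndomorphism hX hM c
  have hFadj : ∀ y w, k3HilbertForm 2 (φ (F y)) (φ w) = k3HilbertForm 2 (φ y) (φ (F w)) :=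
    classEndomorphism_selfAdjoint hX hM hF
  obtain ⟨πT, hT1, hT2, hT3, hT4, hT5, hT6, hT7⟩ := exists_transcendentalProjector hX hM
  obtain ⟨hfrat, hfh, hfN, hfT, hfadj, hsplitF⟩ :=
    classEndomorphism_transcendentalPart hX hM hcrat hc22 hF hT1 hT3 hT4 hT5 hT6 hT7
  have hNT : ∀ n ∈ algebraicClasses X 1, ∀ w, k3HilbertForm 2 (φ n) (φ (πT w)) = 0 := fun n hn w => by
    rw [k3HilbertForm_comm]; exact hT3 w n hn
  have hN11 : ∀ d ∈ algebraicClasses X 1, IsOfHodgeType 4 X 2 1 1 d := fun d hd =>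
    isOfHodgeType_of_mem_algebraicClasses_of_isSmoothProjective hX 1 hd
  -- `SpannedByGraph` applied to `f = πT F πT`
  obtain ⟨k, cc, g, hg, hfsum⟩ := hSG (πT ∘ₗ F ∘ₗ πT)
    (fun y hy => by rw [LinearMap.comp_apply, LinearMap.comp_apply]; exact hfrat y hy)
    (fun i j y hy => by rw [LinearMap.comp_apply, LinearMap.comp_apply]; exact hfh i j y hy)
    (fun d hd => by rw [LinearMap.comp_apply, LinearMap.comp_apply]; exact hfN d hd)
    (fun y d hd => by rw [LinearMap.comp_apply, LinearMap.comp_apply]; exact hfT y d hd)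
  have hfy : ∀ y, πT (F (πT y)) = ∑ i, (cc i : ℂ) • g i (πT y) := fun y => by
    have := hfsum (πT y) (hT3 y)
    rwa [LinearMap.comp_apply, LinearMap.comp_apply, hT2 (πT y) (hT3 y)] at this
  -- the `gᵢ` preserve `N¹(X)` (Lefschetz `(1,1)`)
  have hgN : ∀ i, ∀ d ∈ algebraicClasses X 1, g i d ∈ algebraicClasses X 1 := by
    have hspan := supportedClasses_eq_span_isRationalClass hX 2 1
    change algebraicClasses X 1 = Submodule.span ℂ
      {c : complexBetti X 2 | IsRationalClass c ∧ c ∈ algebraicClasses X 1} at hspan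
    intro i d hd
    rw [hspan] at hd
    have hle : Submodule.span ℂ {c : complexBetti X 2 | IsRationalClass c ∧ c ∈ algebraicClasses X 1} ≤
        (algebraicClasses X 1).comap (g i) := by
      refine Submodule.span_le.2 ?_
      rintro d ⟨hdrat, hdalg⟩
      exact lefschetzOneOne_rational_holds hX _ ((hg i).1 _ hdrat) ((hg i).2.1 1 1 _ (hN11 d hdalg))
    exact hle hd
  -- bilinear bookkeeping
  set qXform : LinearMap.BilinForm ℂ (complexBetti X 2) :=
    (Matrix.toBilin' (Matrix.map (k3HilbertGram 2) (Int.cast : ℤ → ℂ))).compl₁₂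
      (φ : complexBetti X 2 →ₗ[ℂ] (K3HilbertIndex → ℂ)) (φ : complexBetti X 2 →ₗ[ℂ] (K3HilbertIndex → ℂ))
    with hqXform
  have hqXapp : ∀ y w, qXform y w = k3HilbertForm 2 (φ y) (φ w) := fun y w => by
    rw [hqXform, LinearMap.compl₁₂_apply, qC_apply]; rfl
  have hqsub : ∀ a b w : complexBetti X 2, k3HilbertForm 2 (φ (a - b)) (φ w) =
      k3HilbertForm 2 (φ a) (φ w) - k3HilbertForm 2 (φ b) (φ w) := fun a b w => by
    rw [← hqXapp, ← hqXapp, ← hqXapp, map_sub, LinearMap.sub_apply]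
  -- `q(gᵢ (πT y), w) = q(gᵢ y, w) − q(gᵢ y_N, w_N)`
  have hgsplit : ∀ i y w, k3HilbertForm 2 (φ (g i (πT y))) (φ w) =
      k3HilbertForm 2 (φ (g i y)) (φ w) - k3HilbertForm 2 (φ (g i (y - πT y))) (φ (w - πT w)) := by
    intro i y w
    have e1 : g i (πT y) = g i y - g i (y - πT y) := by rw [map_sub]; abel
    have hw : w = (w - πT w) + πT w := by abel
    have e2 : k3HilbertForm 2 (φ (g i (y - πT y))) (φ w) =
        k3HilbertForm 2 (φ (g i (y - πT y))) (φ (w - πT w)) := by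
      conv_lhs => rw [hw, map_add, k3HilbertForm_add_right, hNT _ (hgN i _ (hT4 y)) w, add_zero]
    rw [e1, hqsub, e2]
  -- `q(f y, w) = Σ cᵢ (q(gᵢ y, w) − q(gᵢ y_N, w_N))`
  have hqf : ∀ y w, k3HilbertForm 2 (φ (πT (F (πT y)))) (φ w) = ∑ i, (cc i : ℂ) *
      (k3HilbertForm 2 (φ (g i y)) (φ w) - k3HilbertForm 2 (φ (g i (y - πT y))) (φ (w - πT w))) := by
    intro y w
    rw [← hqXapp, hfy, map_sum, LinearMap.sum_apply]
    refine Finset.sum_congr rfl fun i _ => ?_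
    rw [map_smul, LinearMap.smul_apply, smul_eq_mul, hqXapp, hgsplit]
  -- the symmetric correction form `β` on `N¹(X)`
  set B : complexBetti X 2 →ₗ[ℂ] complexBetti X 2 →ₗ[ℂ] ℂ :=
    qXform.compl₁₂ F LinearMap.id - ∑ i, (cc i : ℂ) • qXform.compl₁₂ (g i) LinearMap.id with hBraw
  have hBdef : ∀ u v, B u v = k3HilbertForm 2 (φ (F u)) (φ v) -
      ∑ i, (cc i : ℂ) * k3HilbertForm 2 (φ (g i u)) (φ v) := by
    intro u v
    rw [hBraw, LinearMap.sub_apply, LinearMap.sub_apply, LinearMap.compl₁₂_apply, LinearMap.id_apply, hqXapp,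
      LinearMap.sum_apply, LinearMap.sum_apply]
    congr 1
    refine Finset.sum_congr rfl fun i _ => ?_
    rw [LinearMap.smul_apply, LinearMap.smul_apply, LinearMap.compl₁₂_apply, LinearMap.id_apply, hqXapp,
      smul_eq_mul]
  clear_value B
  set β : complexBetti X 2 →ₗ[ℂ] complexBetti X 2 →ₗ[ℂ] ℂ := (1 / 2 : ℂ) • (B + B.flip) with hβraw
  have hβdef : ∀ u v, β u v = 1 / 2 * (B u v + B v u) := fun u v => by
    rw [hβraw, LinearMap.smul_apply, LinearMap.smul_apply, LinearMap.add_apply, LinearMap.add_apply,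
      LinearMap.flip_apply, smul_eq_mul]
  clear_value β
  have hβsymm : ∀ u v, β u v = β v u := fun u v => by rw [hβdef, hβdef, add_comm]
  have hqr : ∀ n ∈ algebraicClasses X 1, ∀ y : complexBetti X 2,
      k3HilbertForm 2 (φ n) (φ (y - πT y)) = k3HilbertForm 2 (φ n) (φ y) := by
    intro n hn y
    rw [map_sub, sub_eq_add_neg, k3HilbertForm_add_right, ← neg_one_smul ℂ, k3HilbertForm_smul_right,
      hNT n hn y, mul_zero, add_zero]
  -- the graph classes and the candidate
  choose cg hcgalg t hcg using fun i => (hg i).2.2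
  obtain ⟨c', hc'alg, hc'⟩ := exists_algebraicClass_of_symmetricForm hO hcup hX hK hM
    (-(∑ i, (cc i : ℂ) / 2 * t i)) β hβsymm (fun y => y - πT y) hT4 hqr
  obtain ⟨c'', hc''def⟩ : ∃ c'' : complexBetti X (2 * 2), c'' = (∑ i, ((cc i : ℂ) / 2) • cg i) + c' :=
    ⟨_, rfl⟩
  have hc''alg : c'' ∈ algebraicClasses X 2 := by
    rw [hc''def]
    exact Submodule.add_mem _ (Submodule.sum_mem _ fun i _ => Submodule.smul_mem _ _ (hcgalg i)) hc'alg
  have hcup3 : ∀ y w : complexBetti X 2, Cup3[c, y, w] = Cup3[c'', y, w] := by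
    intro y w
    have hL1 : ∀ A A' : complexBetti X (2 * 2), Cup3[A + A', y, w] = Cup3[A, y, w] + Cup3[A', y, w] := by
      intro A A'; simp only [map_add, LinearMap.add_apply]
    have hL2 : ∀ (u : ℂ) (A : complexBetti X (2 * 2)), Cup3[u • A, y, w] = u • Cup3[A, y, w] := by
      intro u A; simp only [map_smul, LinearMap.smul_apply]
    have hL3 : ∀ A : Fin k → complexBetti X (2 * 2), Cup3[∑ i, A i, y, w] = ∑ i, Cup3[A i, y, w] := by
      intro A; simp only [map_sum, LinearMap.sum_apply]
    have hrhs : Cup3[c'', y, w] = ((∑ i, (cc i : ℂ) / 2 * (t i * k3HilbertForm 2 (φ y) (φ w) +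
        k3HilbertForm 2 (φ (g i y)) (φ w) + k3HilbertForm 2 (φ (g i w)) (φ y))) +
        (-(∑ i, (cc i : ℂ) / 2 * t i) * k3HilbertForm 2 (φ y) (φ w) + β (y - πT y) (w - πT w))) • P := by
      rw [hc''def, hL1, hL3, hc']
      conv_rhs => rw [add_smul, Finset.sum_smul]
      congr 1
      refine Finset.sum_congr rfl fun i _ => ?_
      rw [hL2, hcg, smul_smul]
    rw [hF, hrhs]
    congr 1
    have h1 : ∑ i, (cc i : ℂ) / 2 * (t i * k3HilbertForm 2 (φ y) (φ w) +
        k3HilbertForm 2 (φ (g i y)) (φ w) + k3HilbertForm 2 (φ (g i w)) (φ y)) =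
        (∑ i, (cc i : ℂ) / 2 * t i) * k3HilbertForm 2 (φ y) (φ w) +
          1 / 2 * ∑ i, (cc i : ℂ) * k3HilbertForm 2 (φ (g i y)) (φ w) +
          1 / 2 * ∑ i, (cc i : ℂ) * k3HilbertForm 2 (φ (g i w)) (φ y) := by
      rw [Finset.sum_mul, Finset.mul_sum, Finset.mul_sum, ← Finset.sum_add_distrib, ← Finset.sum_add_distrib]
      exact Finset.sum_congr rfl fun i _ => by ring
    have h2 : ∀ u v : complexBetti X 2, ∑ i, (cc i : ℂ) * (k3HilbertForm 2 (φ (g i u)) (φ v) -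
        k3HilbertForm 2 (φ (g i (u - πT u))) (φ (v - πT v))) =
        ∑ i, (cc i : ℂ) * k3HilbertForm 2 (φ (g i u)) (φ v) -
          ∑ i, (cc i : ℂ) * k3HilbertForm 2 (φ (g i (u - πT u))) (φ (v - πT v)) := fun u v => by
      rw [← Finset.sum_sub_distrib]
      exact Finset.sum_congr rfl fun i _ => by ring
    have hfw : k3HilbertForm 2 (φ (πT (F (πT w)))) (φ y) = k3HilbertForm 2 (φ (πT (F (πT y)))) (φ w) := by
      rw [hfadj w y, k3HilbertForm_comm]
    have key : k3HilbertForm 2 (φ (πT (F (πT y)))) (φ w) =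
        1 / 2 * (∑ i, (cc i : ℂ) * k3HilbertForm 2 (φ (g i y)) (φ w) -
          ∑ i, (cc i : ℂ) * k3HilbertForm 2 (φ (g i (y - πT y))) (φ (w - πT w))) +
        1 / 2 * (∑ i, (cc i : ℂ) * k3HilbertForm 2 (φ (g i w)) (φ y) -
          ∑ i, (cc i : ℂ) * k3HilbertForm 2 (φ (g i (w - πT w))) (φ (y - πT y))) := by
      rw [← h2, ← h2, ← hqf y w, ← hqf w y, hfw]; ring
    have hQF : k3HilbertForm 2 (φ (F (w - πT w))) (φ (y - πT y)) =
        k3HilbertForm 2 (φ (F (y - πT y))) (φ (w - πT w)) := by rw [hFadj, k3HilbertForm_comm]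
    rw [hsplitF y w, key, h1, hβdef, hBdef, hBdef, hQF]
    ring
  exact eq_of_cup3_eq hV hX hK hcup3 ▸ hc''alg

/-- **HC⁴(X) in every degree for a marked smooth projective `K3^{[2]}`-type fourfold with `SpannedByGraph`**
(degree `4` above; the others by Lefschetz `(1,1)` and hard Lefschetz, as in gen 6's wrapper); modulo
{Verbitsky–Guan, O'Grady, Voisin}. [cite: Zarhin1983HodgeGroupsK3, Thm. 1.5.1]
[cite: VoisinHodgeI2002, Thm. 11.30 and Thm. 6.25] -/
theorem hodgeConjectureFor_of_spannedByGraphClasses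
    (hV : VerbitskyGuan_cohomology_K3HilbertSquareType) (hO : OGrady2008_dualBBFClass_algebraic)
    (hcup : Voisin2003_cupProduct_algebraicClasses)
    (hX : IsSmoothProjective 4 X) (hK : IsOfK3HilbertSquareType X) (hM : MarkedK3Sq[X, φ, P, z])
    (hSG : SpannedByGraph[X, φ, P]) : HodgeConjectureFor 4 X :=
  ⟨nonempty_hodgeModel_holds hX, fun p c hc hH ↦
    hodgeClasses_algebraic_fourfold_of_hodgeTwoTwo lefschetzOneOne_rational_holds
      (nonempty_hardLefschetzNFold_holds 4 X) hX
      (fun _ hc' hH' ↦ mem_algebraicClasses_two_of_spannedByGraphClasses hV hO hcup hX hK hM hSG hc' hH')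
      p c hc hH⟩

/-! ### The cycle-induced sector of the target -/

/-- **The CYCLE-INDUCED SECTOR of `K3Sq2TypeHodge`: HC⁴(X) for every marked smooth projective `K3^{[2]}`-type
fourfold whose rational Hodge endomorphisms of `T(X)` are spanned by endomorphisms induced by algebraic classes on
`X × X`** (`SpannedByCycle`: each spanning `gᵢ = [Zᵢ]_*`, `Zᵢ ∈ A⁴(X ⊗ X)`, rational and type-preserving), modulo
{`VerbitskyGuan_cohomology_K3HilbertSquareType`, `OGrady2008_dualBBFClass_algebraic`, `QInvAlgebraic`,
`Voisin2003_cupProduct_algebraicClasses`}: `κ_{gᵢ}` is algebraic (`kappaClass_mem_algebraicClasses_of_corrAction`)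
and is a graph class for `gᵢ` (`exists_graphClass_of_kappaClass`), so `SpannedByGraph` holds and
`hodgeConjectureFor_of_spannedByGraphClasses` concludes. The isometry third (Markman 2024: isometries are
cycle-induced) and the real-multiplication residue of crux #5 with a CYCLE-INDUCED generator `t` of
`E = ℚ[t]` (powers by composition of correspondences) are sub-cases. CONDITIONAL; credits nothing.
[cite: Markman2024, §1.1 Thm. 1.1] [cite: Varesco2023, §2 (p. 8)] [cite: CharlesMarkman2013, Thm. 1.1 (§1)] -/
theorem hodgeConjectureFor_of_spannedByCycleInduced
    (hV : VerbitskyGuan_cohomology_K3HilbertSquareType) (hO : OGrady2008_dualBBFClass_algebraic)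
    (hQ : QInvAlgebraic) (hcup : Voisin2003_cupProduct_algebraicClasses)
    (hX : IsSmoothProjective 4 X) (hK : IsOfK3HilbertSquareType X) (hM : MarkedK3Sq[X, φ, P, z])
    (hSC : SpannedByCycle[X, φ, hX]) : HodgeConjectureFor 4 X := by
  refine hodgeConjectureFor_of_spannedByGraphClasses hV hO hcup hX hK hM ?_
  intro f hfrat hfh hfN hfT
  obtain ⟨k, cc, g, hg, hfsum⟩ := hSC f hfrat hfh hfN hfT
  refine ⟨k, cc, g, fun i => ⟨(hg i).1, (hg i).2.1, ?_⟩, hfsum⟩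
  obtain ⟨Z, hZ, hgZ⟩ := (hg i).2.2
  exact exists_graphClass_of_kappaClass hM (g i)
    (kappaClass_mem_algebraicClasses_of_corrAction hQ hcup
      (OrientationFamily.hasPoincareDuality complexOrientationFamily) hX hK hM hZ (g i) hgZ)

/-- **The cycle-induced sector from the route's published facts**: `QInvAlgebraic` discharged by
Charles–Markman 2013 + Verbitsky–Guan (`qInvAlgebraic_of_charlesMarkman`, gen 2 of seat 19716-p2) and the
multiplicativity of algebraic classes by the tree's `Theorems.Voisin2003_cupProduct_algebraicClasses_holds`:
HC⁴(X) for every marked smooth projective `K3^{[2]}`-type `X` with `SpannedByCycle`, modulo {Verbitsky–Guan,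
O'Grady, Charles–Markman}. CONDITIONAL; credits nothing; crux #5 stays open (its content is now: «the RM field
of T(X) is spanned by cycle-induced endomorphisms»). [cite: CharlesMarkman2013, Thm. 1.1 (§1)]
[cite: Markman2024, §1.1 Thm. 1.1] [cite: OGrady2008NumericalK3Square, §3 proof of Prop. 3.2] -/
theorem hodgeConjectureFor_of_spannedByCycleInduced_of_charlesMarkman
    (hV : VerbitskyGuan_cohomology_K3HilbertSquareType) (hO : OGrady2008_dualBBFClass_algebraic)
    (hB : CharlesMarkman2013_lefschetzStandard_K3HilbertType)
    (hX : IsSmoothProjective 4 X) (hK : IsOfK3HilbertSquareType X) (hM : MarkedK3Sq[X, φ, P, z])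
    (hSC : SpannedByCycle[X, φ, hX]) : HodgeConjectureFor 4 X :=
  hodgeConjectureFor_of_spannedByCycleInduced hV hO (qInvAlgebraic_of_charlesMarkman hV hB)
    Theorems.Voisin2003_cupProduct_algebraicClasses_holds hX hK hM hSC

end Summit.HodgeConjecture.HodgeConjecture.Theorems.MarkmanPartnerTransport.PartnerLattice
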